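import Summits.RiemannHypothesis.RiemannHypothesis.Theorems.Splittings.LiIndexSetsRecurrence
import HarnessLib

/-!
# Splittings — Li index sets, part 3/3: Bombieri–Lagarias along a RECURRENT index set; at the zeta level
# «λ_n ≥ 0 on a recurrent S» IS RH, and for EVERY `S ⊆ ℕ` one of `S`, `Sᶜ` carries RH alone (BP-6)

Cell rh-split, seat rh-split-li-neg g2 (brief sha16 f79c5f09d8bcb036), card `run/shared/lean/pub/rh-split/cards/SPLIT-li-neg.md`
gen-2 addendum.  Proved here (no `sorry`, standard axioms; notions from part 2/3 `LiIndexSetsRecurrence.lean`):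

* `exists_tsum_neg_on` / `exists_tsum_neg_on_pos`, `multisetLiCriterionOn_of_isLiRecurrent` — **Bombieri–Lagarias
  along a recurrent index set**: for every Bombieri–Lagarias family (multiset `ρ_i ≠ 0, 1`, multiplicities, summable
  reflected weight), positivity of the Li sums `Σ' m_i Re[1 − (1 − 1/ρ_i)ⁿ]` for the indices `n ∈ S` ALONE forces
  `Re ρ_i ≥ ½` for all `i` — Bombieri–Lagarias' proof of Thm 1 (tree `BombieriLagarias.exists_tsum_neg`) VERBATIM
  with the Dirichlet/Bolzano–Weierstrass step run inside `S`; `not_multisetLiCriterionOn_primes` /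
  `not_multisetLiCriterionOn_odd` — the multiset-level criterion FAILS on the primes and on the odd numbers
  (`q`-Beurling family of part 2/3);
* `riemannHypothesis_iff_liPosOn` — for every recurrent `S`: `RH ⟺ (λ_n ≥ 0 for all n ∈ S)`, F1-free; this contains
  the g0 tails (`CostumeDetectors.rh_of_liTail`), BP-1's progressions and their tails
  (`riemannHypothesis_iff_liPosOn_mul_tail`, re-proved by the OTHER road), block-sum sets
  (`riemannHypothesis_iff_liPosOn_blockSums`) and THICK sets (`riemannHypothesis_iff_liPosOn_thick`);
* `liPosOn_dichotomy`, `liPosOn_finite_colouring`, `rh_of_liPosOn_and_compl`, `li_index_dichotomy_raw` — **the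
  index-set DICHOTOMY (BY-PRODUCT BP-6)**: for EVERY `S ⊆ ℕ`, `(RH ↔ λ_n ≥ 0 ∀ n ∈ S) ∨ (RH ↔ λ_n ≥ 0 ∀ n ∉ S)` —
  no index splitting `LiPosOn S ∧ LiPosOn Sᶜ ⟹ RH` has slack on both sides (the structural reason the (li, neg) row
  of the cell is «no slack»); `li_index_dichotomy_raw` is the definition-free spelling.

References: [BombieriLagarias1999] Thm. 1; [Li1997].

Provenance: cell rh-split, seat rh-split-li-neg g2, scratch `HOME/rh-split-li-neg/LiIndexSets.lean` (sha16
a6d03a2d9de497a7, 964 lines, namespace `…Scratch.LiIndexSets`; proofs verbatim), re-homed under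
`Theorems/Splittings/` in three files (`LiIndexSetsPrelims` — definition-free estimates; `LiIndexSetsRecurrence` —
the notions `IsLiRecurrent` / `LiPosOn` / `IsThick` / `beurlingFamily` / `MultisetLiCriterionOn` and their API;
`LiIndexSets` — Bombieri–Lagarias along a recurrent index set and the zeta-level dichotomy) by rh-split-typer-1 g2
on the lead's ruling 2026-08-26T20:32Z (BY-PRODUCT BP-6; optional filing after referee replay + label).  Referee
(rh-split-ref g0) addendum 20:37Z on cards/SPLIT-li-neg.md: replay rc 0, std on `riemannHypothesis_iff_liPosOn`;
«dichotomy (RH ↔ LiPosOn S) ∨ (RH ↔ LiPosOn Sᶜ) for EVERY S — partition-regularity step and q-Beurling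
non-recurrent witness re-checked by hand; LABEL: Li index axis = NO SLACK BY THEOREM (recurrent parts RH-equivalent
alone, F1-free; non-recurrent parts RH-implied, ζ-level converse undecided, multiset-level refuted in kernel)».
Typer-1 g2 replay of the 964-line scratch: farm rc 0, 0 warnings, 0 sorry, `#print axioms li_index_dichotomy_raw` =
[propext, Classical.choice, Quot.sound].

HONEST LABEL: «SPLITTING SEARCH over kernel-typed RH-EQUIVALENCES; a splitting A ∧ B ⟹ RH is CONDITIONAL
bookkeeping unless A and B are both proved; nothing here bears on the truth of RH.»
-/

set_option linter.dupNamespace false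

noncomputable section

open Complex Filter Topology Set
open scoped ComplexConjugate Real

namespace Summit.RiemannHypothesis.RiemannHypothesis.Theorems.Splittings.LiIndexSets

open Literature.NumberTheory.LFunctions
open Literature.NumberTheory.LFunctions.BombieriLagarias
open Summit.RiemannHypothesis.RiemannHypothesis.Theorems.Splittings

/-! ## §1 Bombieri–Lagarias along a recurrent index set (their proof verbatim, Step 6 inside `S`) -/

section BL

variable {ι : Type*} {ρ : ι → ℂ} {m : ι → ℕ}

/-- **Bombieri–Lagarias (2) ⇒ (1) along a recurrent index set, contrapositive.**  If some `ρ_{i₀}` has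
`Re ρ_{i₀} > 1/2` and `S` is recurrent, some Bombieri–Lagarias sum with index `n ∈ S` is negative.
Bombieri–Lagarias' proof (tree `BombieriLagarias.exists_tsum_neg`) VERBATIM, the simultaneous-recurrence
step (their Dirichlet box) being taken inside `S`. [cite: BombieriLagarias1999, Theorem 1, proof] -/
theorem exists_tsum_neg_on (hm : ∀ i, 0 < m i) (h1 : ∀ i, ρ i ≠ 1) (hR : Summable (weight ρ m))
    {i₀ : ι} (hi₀ : 1 / 2 < (ρ i₀).re) {S : Set ℕ} (hS : IsLiRecurrent S) :
    ∃ n ∈ S, 1 ≤ n ∧ ∑' i, (m i : ℝ) * (1 - (1 - 1 / ρ i)⁻¹ ^ n).re < 0 := by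
  classical
  set w : ι → ℂ := fun i ↦ (1 - 1 / ρ i)⁻¹ with hw
  set W : ι → ℝ := weight ρ m with hWdef
  set T : ℝ := ∑' i, W i with hTdef
  have hW0 : ∀ i, 0 ≤ W i := weight_nonneg ρ m
  have hT0 : 0 ≤ T := tsum_nonneg hW0
  -- Step 1: level sets `{μ ≤ |w_i|}`, `μ > 1`, are finite
  have hfinlev : ∀ μ : ℝ, 1 < μ → {i | μ ≤ ‖w i‖}.Finite := by
    intro μ hμ
    refine (finite_norm_le hm hR (max 1 (3 / (μ ^ 2 - 1)) + 1)).subset fun i hi ↦ ?_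
    have hb := norm_sub_one_le_of_le_norm hμ (h1 i) hi
    simp only [Set.mem_setOf_eq]
    calc ‖ρ i‖ = ‖(ρ i - 1) + 1‖ := by ring_nf
      _ ≤ ‖ρ i - 1‖ + ‖(1 : ℂ)‖ := norm_add_le _ _
      _ ≤ max 1 (3 / (μ ^ 2 - 1)) + 1 := by rw [norm_one]; linarith
  -- Step 2: the maximal modulus `λ`
  have hl1 : 1 < ‖w i₀‖ := (one_lt_norm_inv_one_sub_inv_iff (h1 i₀)).2 hi₀
  set A : Finset ι := (hfinlev _ hl1).toFinset with hA
  have hA₀ : i₀ ∈ A := by simp [hA]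
  have hAne : A.Nonempty := ⟨i₀, hA₀⟩
  set lam : ℝ := A.sup' hAne (fun i ↦ ‖w i‖) with hlam
  have hlamge : ‖w i₀‖ ≤ lam := Finset.le_sup' (fun i ↦ ‖w i‖) hA₀
  have hlam1 : 1 < lam := hl1.trans_le hlamge
  have hlam0 : 0 < lam := zero_lt_one.trans hlam1
  have hle_lam : ∀ i, ‖w i‖ ≤ lam := by
    intro i
    by_cases hi : i ∈ A
    · exact Finset.le_sup' (fun i ↦ ‖w i‖) hi
    · have : ¬ ‖w i₀‖ ≤ ‖w i‖ := by simpa [hA] using hi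
      exact (le_of_lt (not_le.1 this)).trans hlamge
  -- Step 3: the top set `B` (finite, nonempty) and its mass `MB ≥ 1`
  set B : Finset ι := (hfinlev lam hlam1).toFinset with hB
  have hmemB : ∀ i, i ∈ B ↔ ‖w i‖ = lam := by
    intro i
    simp only [hB, Set.Finite.mem_toFinset, Set.mem_setOf_eq]
    exact ⟨fun h ↦ le_antisymm (hle_lam i) h, fun h ↦ h.ge⟩
  obtain ⟨i₁, hi₁A, hi₁⟩ := Finset.exists_mem_eq_sup' hAne (fun i ↦ ‖w i‖)
  have hi₁B : i₁ ∈ B := (hmemB i₁).2 hi₁.symm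
  set MB : ℝ := ∑ i ∈ B, (m i : ℝ) with hMBdef
  have hMB1 : 1 ≤ MB := by
    calc (1 : ℝ) ≤ m i₁ := by exact_mod_cast hm i₁
      _ ≤ MB := Finset.single_le_sum (f := fun i ↦ (m i : ℝ)) (fun i _ ↦ Nat.cast_nonneg _) hi₁B
  -- Step 4: a uniform gap `|w_i| ≤ ν < λ` off `B`
  set μ : ℝ := (1 + lam) / 2 with hμ
  have hμ1 : 1 < μ := by rw [hμ]; linarith
  have hμlam : μ < lam := by rw [hμ]; linarith
  set A' : Finset ι := (hfinlev μ hμ1).toFinset with hA'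
  set s : Finset ι := A' \ B with hs
  set ν : ℝ := s.fold max μ (fun i ↦ ‖w i‖) with hν
  have hνlam : ν < lam := by
    rw [hν, Finset.fold_max_lt]
    refine ⟨hμlam, fun i hi ↦ lt_of_le_of_ne (hle_lam i) fun h ↦ ?_⟩
    exact (Finset.mem_sdiff.1 hi).2 ((hmemB i).2 h)
  have hμν : μ ≤ ν := by rw [hν, Finset.le_fold_max]; exact Or.inl le_rfl
  have hν0 : 0 ≤ ν := le_trans (by linarith) hμν
  have hoffB : ∀ i, i ∉ B → ‖w i‖ ≤ ν := by
    intro i hi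
    by_cases hi' : i ∈ A'
    · rw [hν, Finset.le_fold_max]
      exact Or.inr ⟨i, Finset.mem_sdiff.2 ⟨hi', hi⟩, le_rfl⟩
    · have : ¬ μ ≤ ‖w i‖ := by simpa [hA'] using hi'
      exact (le_of_lt (not_le.1 this)).trans hμν
  -- Step 5: for large `n` the main term wins: `(MB + 27 T n² + 9 T n² νⁿ)/λⁿ < MB/2`
  have hlim : Tendsto (fun n : ℕ ↦ MB * (1 / lam) ^ n + 27 * T * ((n : ℝ) ^ 2 * (1 / lam) ^ n)
      + 9 * T * ((n : ℝ) ^ 2 * (ν / lam) ^ n)) atTop (𝓝 0) := by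
    have hq1 : |1 / lam| < 1 := by
      rw [abs_of_pos (by positivity), div_lt_one hlam0]; exact hlam1
    have hq2 : |ν / lam| < 1 := by
      rw [abs_of_nonneg (by positivity), div_lt_one hlam0]; exact hνlam
    have t1 : Tendsto (fun n : ℕ ↦ (1 / lam) ^ n) atTop (𝓝 0) := by
      simpa using tendsto_pow_const_mul_const_pow_of_abs_lt_one 0 hq1
    have t2 := tendsto_pow_const_mul_const_pow_of_abs_lt_one 2 hq1
    have t3 := tendsto_pow_const_mul_const_pow_of_abs_lt_one 2 hq2
    have := (t1.const_mul MB).add ((t2.const_mul (27 * T)).add (t3.const_mul (9 * T)))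
    simpa [add_assoc] using this
  obtain ⟨N₀, hN₀⟩ := eventually_atTop.1
    (hlim.eventually_lt_const (show (0 : ℝ) < MB / 2 by linarith))
  -- Step 6: simultaneous recurrence on `B` with `z_i = w_i/λ`, the exponent taken INSIDE `S`
  obtain ⟨n, hnS, hnN, hcos⟩ := hS.finset B (fun i ↦ w i / (lam : ℂ))
    (fun i hi ↦ by
      rw [norm_div, Complex.norm_real, Real.norm_of_nonneg hlam0.le, (hmemB i).1 hi,
        div_self hlam0.ne']) (max N₀ 1)
  have hn1 : 1 ≤ n := (le_max_right _ _).trans hnN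
  have hnN₀ : N₀ ≤ n := (le_max_left _ _).trans hnN
  have hn1' : (1 : ℝ) ≤ n := by exact_mod_cast hn1
  have hnum : MB + 27 * T * (n : ℝ) ^ 2 + 9 * T * (n : ℝ) ^ 2 * ν ^ n < MB / 2 * lam ^ n := by
    have h := hN₀ n hnN₀
    have hlampow : 0 < lam ^ n := pow_pos hlam0 n
    have e : MB * (1 / lam) ^ n + 27 * T * ((n : ℝ) ^ 2 * (1 / lam) ^ n)
        + 9 * T * ((n : ℝ) ^ 2 * (ν / lam) ^ n)
        = (MB + 27 * T * (n : ℝ) ^ 2 + 9 * T * (n : ℝ) ^ 2 * ν ^ n) / lam ^ n := by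
      rw [div_pow, div_pow, one_pow]
      field_simp
    rw [e, div_lt_iff₀ hlampow] at h
    exact h
  refine ⟨n, hnS, hn1, ?_⟩
  -- Step 7: termwise majorant `g`
  set K : ℝ := 9 * (n : ℝ) ^ 2 * (1 + ν ^ n) + 18 * (n : ℝ) ^ 2 with hK
  have hνn : 0 ≤ ν ^ n := pow_nonneg hν0 n
  have hK0 : 0 ≤ K := by positivity
  have hK18 : 18 * (n : ℝ) ^ 2 ≤ K := by
    rw [hK]; nlinarith [sq_nonneg (n : ℝ)]
  have hK9 : 9 * (n : ℝ) ^ 2 * (1 + ν ^ n) ≤ K := by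
    rw [hK]; nlinarith [sq_nonneg (n : ℝ)]
  set f : ι → ℝ := fun i ↦ (m i : ℝ) * (1 - (1 - 1 / ρ i)⁻¹ ^ n).re with hf
  set g : ι → ℝ := fun i ↦ if i ∈ B then (m i : ℝ) * (1 - lam ^ n / 2) else K * W i with hg
  have hfg : ∀ i, f i ≤ g i := by
    intro i
    have hm0 : (0 : ℝ) ≤ m i := Nat.cast_nonneg _
    by_cases hiB : i ∈ B
    · simp only [hf, hg, if_pos hiB]
      have hc := hcos i hiB
      have hpow : (w i) ^ n = ((lam ^ n : ℝ) : ℂ) * (w i / (lam : ℂ)) ^ n := by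
        rw [Complex.ofReal_pow, ← mul_pow, mul_div_cancel₀ _ (Complex.ofReal_ne_zero.2 hlam0.ne')]
      have hre : ((1 - 1 / ρ i)⁻¹ ^ n).re = lam ^ n * ((w i / (lam : ℂ)) ^ n).re := by
        show (w i ^ n).re = _
        rw [hpow, Complex.re_ofReal_mul]
      rw [sub_re, one_re, hre]
      refine mul_le_mul_of_nonneg_left ?_ hm0
      nlinarith [pow_pos hlam0 n]
    · simp only [hf, hg, if_neg hiB]
      by_cases hfar : (n : ℝ) ≤ ‖ρ i - 1‖
      · have ht := abs_re_term_le hn1 hfar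
        calc (m i : ℝ) * (1 - (1 - 1 / ρ i)⁻¹ ^ n).re
            ≤ (m i : ℝ) * (18 * (n : ℝ) ^ 2 * ((1 + |(ρ i).re|) / (1 + ‖ρ i‖) ^ 2)) :=
              mul_le_mul_of_nonneg_left ((le_abs_self _).trans ht) hm0
          _ = 18 * (n : ℝ) ^ 2 * W i := by simp only [hWdef, weight]; ring
          _ ≤ K * W i := mul_le_mul_of_nonneg_right hK18 (hW0 i)
      · have hnear : ‖ρ i - 1‖ < n := not_le.1 hfar
        have hρn : ‖ρ i‖ < n + 1 := by
          calc ‖ρ i‖ = ‖(ρ i - 1) + 1‖ := by ring_nf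
            _ ≤ ‖ρ i - 1‖ + ‖(1 : ℂ)‖ := norm_add_le _ _
            _ < n + 1 := by rw [norm_one]; linarith
        have hone : (1 : ℝ) ≤ 9 * (n : ℝ) ^ 2 * ((1 + |(ρ i).re|) / (1 + ‖ρ i‖) ^ 2) := by
          rw [mul_div_assoc', one_le_div (by positivity)]
          have hρ0 : 0 ≤ ‖ρ i‖ := norm_nonneg _
          calc (1 + ‖ρ i‖) ^ 2 ≤ (3 * (n : ℝ)) ^ 2 := by
                apply pow_le_pow_left₀ (by positivity)
                linarith
            _ = 9 * (n : ℝ) ^ 2 * 1 := by ring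
            _ ≤ 9 * (n : ℝ) ^ 2 * (1 + |(ρ i).re|) := by
                gcongr; linarith [abs_nonneg (ρ i).re]
        have hterm : (1 - (1 - 1 / ρ i)⁻¹ ^ n).re ≤ 1 + ν ^ n := by
          refine (re_one_sub_pow_le _ n).trans ?_
          have : ‖(1 - 1 / ρ i)⁻¹‖ ≤ ν := hoffB i hiB
          gcongr
        have h1ν : 0 ≤ 1 + ν ^ n := by positivity
        calc (m i : ℝ) * (1 - (1 - 1 / ρ i)⁻¹ ^ n).re ≤ (m i : ℝ) * (1 + ν ^ n) :=
              mul_le_mul_of_nonneg_left hterm hm0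
          _ = (m i : ℝ) * (1 + ν ^ n) * 1 := (mul_one _).symm
          _ ≤ (m i : ℝ) * (1 + ν ^ n) *
                (9 * (n : ℝ) ^ 2 * ((1 + |(ρ i).re|) / (1 + ‖ρ i‖) ^ 2)) :=
              mul_le_mul_of_nonneg_left hone (mul_nonneg hm0 h1ν)
          _ = 9 * (n : ℝ) ^ 2 * (1 + ν ^ n) * W i := by simp only [hWdef, weight]; ring
          _ ≤ K * W i := mul_le_mul_of_nonneg_right hK9 (hW0 i)
  -- Step 8: sum the majorant
  have hfs : Summable f := summable_term hm hR n
  set g₁ : ι → ℝ := fun i ↦ if i ∈ B then (m i : ℝ) * (1 - lam ^ n / 2) - K * W i else 0 with hg₁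
  have hg₁s : Summable g₁ :=
    summable_of_ne_finset_zero (s := B) (fun i hi ↦ by simp only [hg₁, if_neg hi])
  have hg₂s : Summable (fun i ↦ K * W i) := hR.mul_left K
  have hgdec : g = fun i ↦ g₁ i + K * W i := by
    funext i
    simp only [hg, hg₁]
    split_ifs <;> ring
  have hgs : Summable g := by rw [hgdec]; exact hg₁s.add hg₂s
  have hg₁sum : ∑' i, g₁ i ≤ MB * (1 - lam ^ n / 2) := by
    rw [tsum_eq_sum (s := B) (fun i hi ↦ by simp only [hg₁, if_neg hi]), hMBdef, Finset.sum_mul]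
    refine Finset.sum_le_sum fun i hi ↦ ?_
    simp only [hg₁, if_pos hi]
    nlinarith [hW0 i, hK0]
  have hgsum : ∑' i, g i ≤ MB * (1 - lam ^ n / 2) + K * T := by
    rw [hgdec, hg₁s.tsum_add hg₂s, tsum_mul_left]
    exact add_le_add hg₁sum le_rfl
  calc ∑' i, f i ≤ ∑' i, g i := hfs.tsum_le_tsum hfg hgs
    _ ≤ MB * (1 - lam ^ n / 2) + K * T := hgsum
    _ = MB + 27 * T * (n : ℝ) ^ 2 + 9 * T * (n : ℝ) ^ 2 * ν ^ n - MB / 2 * lam ^ n := by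
        rw [hK]; ring
    _ < 0 := by linarith

/-- **The `+n` (Li) form along a recurrent set, contrapositive**: a member with `Re ρ_{i₀} < 1/2` forces a
negative Li sum at some index `n ∈ S` (reflection `ρ ↦ 1 − ρ̄`, tree `re_term_one_sub_conj`).
[cite: BombieriLagarias1999, Theorem 1; Li2004, Theorem 2 and p. 494] -/
theorem exists_tsum_neg_on_pos (hm : ∀ i, 0 < m i) (h0 : ∀ i, ρ i ≠ 0) (h1 : ∀ i, ρ i ≠ 1)
    (hR : Summable (weight (fun i ↦ 1 - conj (ρ i)) m)) {i₀ : ι} (hi₀ : (ρ i₀).re < 1 / 2)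
    {S : Set ℕ} (hS : IsLiRecurrent S) :
    ∃ n ∈ S, 1 ≤ n ∧ ∑' i, (m i : ℝ) * (1 - (1 - 1 / ρ i) ^ n).re < 0 := by
  have h1' : ∀ i, 1 - conj (ρ i) ≠ 1 := by
    intro i h
    apply h0 i
    have : conj (ρ i) = 0 := by linear_combination -h
    simpa using this
  have hi₀' : 1 / 2 < ((fun i ↦ 1 - conj (ρ i)) i₀).re := by
    simp only [sub_re, one_re, Complex.conj_re]; linarith
  obtain ⟨n, hnS, hn1, hlt⟩ := exists_tsum_neg_on (ρ := fun i ↦ 1 - conj (ρ i)) hm h1' hR hi₀' hS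
  refine ⟨n, hnS, hn1, ?_⟩
  simp only [re_term_one_sub_conj (h0 _) (h1 _)] at hlt
  exact hlt

end BL

/-- **Bombieri–Lagarias along a recurrent index set**: if `S` is recurrent, the index-set Li criterion
holds for `S` at the multiset level. [cite: BombieriLagarias1999, Theorem 1] -/
theorem multisetLiCriterionOn_of_isLiRecurrent {S : Set ℕ} (hS : IsLiRecurrent S) :
    MultisetLiCriterionOn S := by
  intro ι ρ m hm h0 h1 hR hpos i
  by_contra hlt
  rw [not_le] at hlt
  obtain ⟨n, hnS, hn1, hneg⟩ := exists_tsum_neg_on_pos hm h0 h1 hR hlt hS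
  exact absurd (hpos n hnS hn1) (not_le.2 hneg)

/-- Hence the multiset-level criterion on `S` is sandwiched: recurrent ⟹ criterion ⟹ `S` meets every
`qℕ` infinitely often; in particular it FAILS for the odd numbers, the primes, the squarefree numbers,
the powers of two. -/
theorem not_multisetLiCriterionOn_primes : ¬ MultisetLiCriterionOn {p | p.Prime} :=
  not_multisetLiCriterionOn_of_forall_not_dvd (q := 4) (by norm_num) fun p (hp : p.Prime) _ h4 ↦ by
    rcases hp.eq_one_or_self_of_dvd 4 h4 with h | h
    · omega
    · subst h; exact absurd hp (by norm_num)

/-- The multiset-level index-set Li criterion FAILS on the odd numbers (`2`-Beurling family). -/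
theorem not_multisetLiCriterionOn_odd : ¬ MultisetLiCriterionOn {n | Odd n} :=
  not_multisetLiCriterionOn_of_forall_not_dvd (q := 2) (by norm_num) fun n hn _ h2 ↦ by
    rcases hn with ⟨k, hk⟩; omega

/-! ## §2 Zeta level: Li positivity on a recurrent index set is RH; the dichotomy -/

/-- Cast bookkeeping for the order of a nontrivial zero. -/
private theorem toNat_cast_eq (ρ : ZetaZeros.riemannZetaNontrivialZeros) :
    (((riemannZetaZeroOrder (ρ : ℂ)).toNat : ℕ) : ℝ) = (riemannZetaZeroOrder (ρ : ℂ) : ℝ) := by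
  have h := ZetaZeros.riemannZetaNontrivialZeros.one_le_order ρ.2
  have : ((riemannZetaZeroOrder (ρ : ℂ)).toNat : ℤ) = riemannZetaZeroOrder (ρ : ℂ) :=
    Int.toNat_of_nonneg (by omega)
  exact_mod_cast this

/-- Nontrivial zeros are `≠ 0`. -/
private theorem ne_zero_of_mem (ρ : ZetaZeros.riemannZetaNontrivialZeros) : (ρ : ℂ) ≠ 0 := by
  intro h
  have := ZetaZeros.riemannZetaNontrivialZeros.re_pos ρ.2
  rw [h] at this
  simp at this

/-- `Re ρ ≥ 1/2` for all nontrivial zeros gives RH (pairing `ρ ↦ 1 - conj ρ`). -/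
private theorem riemannHypothesis_of_forall_half_le_re
    (h : ∀ ρ ∈ ZetaZeros.riemannZetaNontrivialZeros, 1 / 2 ≤ ρ.re) : _root_.RiemannHypothesis := by
  intro s hs htriv _
  have hmem : s ∈ ZetaZeros.riemannZetaNontrivialZeros := by
    refine ⟨hs, ?_⟩
    rintro ⟨k, hk⟩
    exact htriv ⟨k, hk.symm⟩
  have hge := h s hmem
  have hle := h (1 - conj s) (ZetaZeros.riemannZetaNontrivialZeros.one_sub_conj_mem hmem)
  simp only [sub_re, one_re, Complex.conj_re] at hle
  linarith

/-- **Li positivity on a recurrent index set implies RH** (F1-free; Bombieri–Lagarias' road inside `S`).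
[cite: BombieriLagarias1999, Theorem 1; Li1997, (1.4)] -/
theorem riemannHypothesis_of_liPosOn {S : Set ℕ} (hS : IsLiRecurrent S) (h : LiPosOn S) :
    _root_.RiemannHypothesis := by
  have hcrit := multisetLiCriterionOn_of_isLiRecurrent hS ZetaZeros.riemannZetaNontrivialZeros
    (fun ρ ↦ (ρ : ℂ)) (fun ρ ↦ (riemannZetaZeroOrder (ρ : ℂ)).toNat)
    (fun ρ ↦ by have := ZetaZeros.riemannZetaNontrivialZeros.one_le_order ρ.2; omega)
    (fun ρ ↦ ne_zero_of_mem ρ) (fun ρ ↦ ZetaZeros.riemannZetaNontrivialZeros.ne_one ρ.2)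
    summable_weight_zetaZeros ?_
  · exact riemannHypothesis_of_forall_half_le_re fun ρ hρ ↦ hcrit ⟨ρ, hρ⟩
  · intro n hnS hn1
    rw [tsum_congr fun ρ ↦ by rw [toNat_cast_eq], ← keiperLiCoeff_eq_tsum_zeros hn1]
    exact h n hnS hn1

/-- **For a recurrent index set `S`: `RH ⟺ λ_n ≥ 0 for all n ∈ S`.** -/
theorem riemannHypothesis_iff_liPosOn {S : Set ℕ} (hS : IsLiRecurrent S) :
    _root_.RiemannHypothesis ↔ LiPosOn S :=
  ⟨fun h n _ hn ↦ (li_criterion_holds.1 h) n hn, riemannHypothesis_of_liPosOn hS⟩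

/-- **The dichotomy: no index splitting of Li's criterion has slack on both sides.**  For EVERY
`S ⊆ ℕ`, Li positivity on `S` or Li positivity on `Sᶜ` is, by itself, equivalent to RH. -/
theorem liPosOn_dichotomy (S : Set ℕ) :
    (_root_.RiemannHypothesis ↔ LiPosOn S) ∨ (_root_.RiemannHypothesis ↔ LiPosOn Sᶜ) :=
  (isLiRecurrent_or_compl S).imp riemannHypothesis_iff_liPosOn riemannHypothesis_iff_liPosOn

/-- **Finite colourings**: in any finite colouring of the indices, some colour class `C` has
`RH ⟺ λ_n ≥ 0 ∀ n ∈ C`. -/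
theorem liPosOn_finite_colouring {k : ℕ} (c : ℕ → Fin k) :
    ∃ j : Fin k, (_root_.RiemannHypothesis ↔ LiPosOn (c ⁻¹' {j})) := by
  have hcov : (⋃ j ∈ (Finset.univ : Finset (Fin k)), c ⁻¹' ({j} : Set (Fin k))) = Set.univ := by
    ext n; simp
  obtain ⟨j, -, hj⟩ := IsLiRecurrent.exists_of_biUnion Finset.univ (fun j ↦ c ⁻¹' ({j} : Set (Fin k)))
    (by rw [hcov]; exact isLiRecurrent_univ)
  exact ⟨j, riemannHypothesis_iff_liPosOn hj⟩

/-- The splitting `LiPosOn S ∧ LiPosOn Sᶜ ⟹ RH` is provable for every `S` — and by `liPosOn_dichotomy`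
one conjunct is already RH. -/
theorem rh_of_liPosOn_and_compl (S : Set ℕ) (hA : LiPosOn S) (hB : LiPosOn Sᶜ) :
    _root_.RiemannHypothesis := by
  rcases isLiRecurrent_or_compl S with h | h
  · exact riemannHypothesis_of_liPosOn h hA
  · exact riemannHypothesis_of_liPosOn h hB

/-- Examples on the recurrent side (all RH-equivalent alone, F1-free): tails, progression tails (BP-1 by
the other road), block-sum sets. -/
theorem riemannHypothesis_iff_liPosOn_mul_tail {q : ℕ} (hq : 1 ≤ q) (K : ℕ) :
    _root_.RiemannHypothesis ↔ LiPosOn {n | ∃ k, K < k ∧ n = q * k} :=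
  riemannHypothesis_iff_liPosOn (isLiRecurrent_mul_tail hq K)

/-- `RH ⟺ λ_n ≥ 0` on the block sums of any sequence of positive integers (IP-type index sets). -/
theorem riemannHypothesis_iff_liPosOn_blockSums (x : ℕ → ℕ) (hx : ∀ j, 1 ≤ x j) :
    _root_.RiemannHypothesis ↔ LiPosOn {n | ∃ m m', m < m' ∧ n = ∑ j ∈ Finset.Ico m m', x j} :=
  riemannHypothesis_iff_liPosOn
    (isLiRecurrent_of_blockSums_mem x hx fun m m' h ↦ ⟨m, m', h, rfl⟩)

/-- **Thick index sets**: if `S` contains arbitrarily long runs of consecutive integers then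
`RH ⟺ λ_n ≥ 0 for all n ∈ S` (new on the index axis: neither a tail nor a progression). -/
theorem riemannHypothesis_iff_liPosOn_thick {S : Set ℕ} (hS : IsThick S) :
    _root_.RiemannHypothesis ↔ LiPosOn S :=
  riemannHypothesis_iff_liPosOn hS.isLiRecurrent

/-- RAW form of the headline (no local definitions). -/
theorem li_index_dichotomy_raw (S : Set ℕ) :
    (_root_.RiemannHypothesis ↔ ∀ n ∈ S, 1 ≤ n → 0 ≤ keiperLiCoeff n) ∨
    (_root_.RiemannHypothesis ↔ ∀ n ∉ S, 1 ≤ n → 0 ≤ keiperLiCoeff n) :=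
  liPosOn_dichotomy S

end Summit.RiemannHypothesis.RiemannHypothesis.Theorems.Splittings.LiIndexSets

end
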